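import Mathlib
import HarnessLib
import Literature.Analysis.FluidPDE.SpaceTimeCalculus
import Summits.NavierStokesRegularity.NavierStokesRegularity.Theorems.PoloidalWindowDoorPoloidalWindowRigidityZShockLocalEnergyCutoff

/-!
# Crux K2 `PoloidalWindowRigidity` (stmt-NavierStokesRegularity-19708), line `z_shock` — R3 infrastructure: the LOCAL ENERGY
# INEQUALITY (domain of dependence with a source, speed `c`) for a balance law `∂ₛe + div f = σ` in `ℝⁿ`

`--supports stmt-NavierStokesRegularity-19708 --as helper` (leafhand-ns-poloidalwindowdoor-3 g5, cell decomp-ns, 2026-08-31).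
**No stub and no summit is closed by this file; Navier–Stokes regularity is NOT proved here (rung 0).**

WHY THIS FILE.  The deciding stub `stub_zShockThickAut` of `Cruxes/PoloidalWindowRigidity/Lines/z_shock.lean` needs rung R3 of the card:
two-sided eternal rigidity for the autonomous height-evolution `w_zz + divₕ(G(w)∇ₕw) = 0` in `2+1` dimensions.  Hand 3-g4 landed its complete
LOCAL ingredient list — the wave-energy identity `∂_z e − divₕ(c² w_z ∇ₕw) = −½G'(w) w_z|∇ₕw|²` and the pointwise flux dominance
`|c² w_z ∂ₙw| ≤ c·e` (`…ZShockWaveEnergy`) — and named as the Lean infrastructure gap of ANY energy method on the thick column the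
integrated form: «disc/cone integration + divergence theorem (domain of dependence)» (exit report 2026-08-31T14:34Z).  This file closes that
gap in abstract form, for every space dimension `n`, every speed `c` and an arbitrary SOURCE, by the smooth-moving-cutoff method of the tree's
cone estimate for Yang–Mills charges (`Literature.Barriers.QuantumFields.NoClassicalGlueballsConeEstimateProofs`: `n = 3`, `c = 1`, `σ = 0`),
whose bracket/profile lemmas it reuses:

* cutoff `χ(s, y) = smoothTransition (a + 1 − (⟨y⟩ + c s))`, `⟨y⟩ = √(1 + |y|²)` — `= 1` where `⟨y⟩ + cs ≤ a`, `= 0` where `⟨y⟩ + cs ≥ a + 1`,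
  smooth, compactly supported in `y`, moving inward at speed `c`;
* `hasDerivAt_coneEnergy`: for jointly smooth `e, σ : ℝ × ℝⁿ → ℝ`, `f : Fin n → ℝ × ℝⁿ → ℝ` with `∂ₛe + Σᵢ ∂ᵢfᵢ = σ`, the cone energy
  `M(s) = ∫ χ(s,y) e(s,y) dy` has `M'(s) = ∫ χ'(⟨y⟩+cs) ⟨y⟩⁻¹ (c⟨y⟩ e + Σᵢ yᵢ fᵢ)(s,y) dy + ∫ χ(s,y) σ(s,y) dy`
  (differentiation under the integral sign `FluidPDE.hasDerivAt_integral_of_support_subset`, balance law, integration by parts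
  `integral_mul_fderiv_eq_neg_fderiv_mul_of_integrable`);
* `deriv_coneEnergy_le`: under FLUX DOMINANCE `0 ≤ c⟨y⟩ e + Σᵢ yᵢ fᵢ` (implied by `|f| ≤ c e`), `M'(s) ≤ ∫ χ σ`;
* `coneEnergy_le_exp_mul`: if moreover `σ ≤ K e` pointwise for `s ≥ t₀`, then `M(t) ≤ exp(K(t − t₀)) M(t₀)` (Grönwall);
* `setIntegral_closedBall_le_exp_mul`: with `e ≥ 0`, the energy in the ball `|y| ≤ ρ` at height `t ≥ t₀` is at most `exp(K(t−t₀))` times the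
  energy at height `t₀` in the ball `|y| ≤ √(1+ρ²) + c(t − t₀) + 1` (domain of dependence at speed `c`, up to the unit transition shell).

For the z_shock wave energy (`e = ½w_z² + ½c²|∇ₕw|²`, `fᵢ = −c² w_z ∂ᵢw`, `σ = ½(c²)'(w) w_z|∇ₕw|²`, `n = 2`, height = time) flux dominance is
`…ZShockWaveEnergy.waveEnergy_flux_le` and `σ ≤ K e` holds on every slab where `(c²)'(w) w_z` is bounded — so on the two-sided bounded `C²`
data of R3 the wave energy obeys two-sided local Grönwall bounds in the height; this is bookkeeping-grade infrastructure, it proves no rigidity.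
presearch: energy method on cones = [Evans, PDE 2nd ed. §2.4.3; corpus:book:alinhac2009 pp.44–46] (textbook); tree: Glassey–Strauss cone
estimate (Fin 3, no source).  [folklore]
-/

noncomputable section

namespace Summit.NavierStokesRegularity.NavierStokesRegularity.Theorems.PoloidalWindowDoorPoloidalWindowRigidityZShockLocalEnergy

-- the problem directory repeats the summit name (`NavierStokesRegularity/NavierStokesRegularity`)
set_option linter.dupNamespace false

open MeasureTheory Set Filter Topology Function Metric
open scoped ContDiff
open Literature.Analysis.FluidPDE
open Summit.NavierStokesRegularity.NavierStokesRegularity.Theorems.PoloidalWindowDoorPoloidalWindowRigidityZShockLocalEnergyCutoff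

/-! ### The cone energy and its height derivative -/

section ConeEnergy

variable {n : ℕ}

/-- Slices of a jointly `C^k` field are `C^k`. [folklore] -/
theorem contDiff_slice {k : WithTop ℕ∞} {w : ℝ → EuclideanSpace ℝ (Fin n) → ℝ} (hw : ContDiff ℝ k (uncurry w)) (s : ℝ) :
    ContDiff ℝ k (w s) :=
  hw.comp (contDiff_prodMk_right s)

/-- Height lines of a jointly `C^k` field are `C^k`. [folklore] -/
theorem contDiff_line {k : WithTop ℕ∞} {w : ℝ → EuclideanSpace ℝ (Fin n) → ℝ} (hw : ContDiff ℝ k (uncurry w))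
    (y : EuclideanSpace ℝ (Fin n)) : ContDiff ℝ k fun s => w s y :=
  hw.comp (contDiff_prodMk_left y)

variable {e σ : ℝ → EuclideanSpace ℝ (Fin n) → ℝ} {f : Fin n → ℝ → EuclideanSpace ℝ (Fin n) → ℝ}

/-- **Height derivative of the cone energy.** For jointly smooth `e`, `fᵢ`, `σ` satisfying the balance law
`∂ₛe + Σᵢ ∂ᵢfᵢ = σ`, the weighted energy `M(s) = ∫ χ_a(⟨y⟩ + cs) e(s, y) dy` is differentiable with
`M'(s) = ∫ χ_a'(⟨y⟩ + cs) ⟨y⟩⁻¹ (c⟨y⟩ e(s, y) + Σᵢ yᵢ fᵢ(s, y)) dy + ∫ χ_a(⟨y⟩ + cs) σ(s, y) dy`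
(differentiate under the integral sign, insert the balance law, integrate by parts: the mantle flux of the sharp-cone computation becomes
the bulk term supported in the transition shell of the cutoff). [folklore] -/
theorem hasDerivAt_coneEnergy (he : ContDiff ℝ ∞ (uncurry e)) (hf : ∀ i, ContDiff ℝ ∞ (uncurry (f i)))
    (hσ : ContDiff ℝ ∞ (uncurry σ))
    (hbal : ∀ s y, deriv (fun s' => e s' y) s +
      ∑ i, fderiv ℝ (f i s) y (EuclideanSpace.single i 1) = σ s y)
    (a c s : ℝ) :
    HasDerivAt (fun s' => ∫ y : EuclideanSpace ℝ (Fin n),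
        Real.smoothTransition (a + 1 - (√(1 + ‖y‖ ^ 2) + c * s')) * e s' y)
      ((∫ y : EuclideanSpace ℝ (Fin n),
          deriv (fun v : ℝ => Real.smoothTransition (a + 1 - v)) (√(1 + ‖y‖ ^ 2) + c * s) / √(1 + ‖y‖ ^ 2) *
            (c * √(1 + ‖y‖ ^ 2) * e s y + ∑ i, y i * f i s y)) +
        ∫ y : EuclideanSpace ℝ (Fin n), Real.smoothTransition (a + 1 - (√(1 + ‖y‖ ^ 2) + c * s)) * σ s y) s := by
  -- Step 1: differentiation under the integral sign on the height set `S = (s - 1, s + 1)`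
  set Φ : ℝ → EuclideanSpace ℝ (Fin n) → ℝ :=
    fun s' y => Real.smoothTransition (a + 1 - (√(1 + ‖y‖ ^ 2) + c * s')) * e s' y with hΦ
  have hSo : IsOpen (Ioo (s - 1) (s + 1)) := isOpen_Ioo
  have hsS : s ∈ Ioo (s - 1) (s + 1) := by constructor <;> linarith
  have hΦs : IsSmoothSpaceTimeOn (Ioo (s - 1) (s + 1)) Φ :=
    ((contDiff_cutoff_uncurry a c).mul he).contDiffOn
  -- a radius beyond which every slice `Φ s'`, `s' ∈ S`, vanishes: `a + 1 - c s' ≤ a + 1 + |c| (|s| + 1)`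
  set R : ℝ := a + 1 + |c| * (|s| + 1) with hR
  have hK : IsCompact (closedBall (0 : EuclideanSpace ℝ (Fin n)) R) := isCompact_closedBall _ _
  have hsupp : ∀ s' ∈ Ioo (s - 1) (s + 1), ∀ y ∉ closedBall (0 : EuclideanSpace ℝ (Fin n)) R, Φ s' y = 0 := by
    intro s' hs' y hy
    rw [mem_closedBall, dist_zero_right, not_le] at hy
    have hs'1 : |s'| ≤ |s| + 1 := by
      have h1 := hs'.1
      have h2 := hs'.2
      rw [abs_le]
      constructor
      · linarith [neg_abs_le s]
      · linarith [le_abs_self s]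
    have hcs : -(c * s') ≤ |c| * (|s| + 1) := by
      calc -(c * s') ≤ |c * s'| := neg_le_abs _
        _ = |c| * |s'| := abs_mul _ _
        _ ≤ |c| * (|s| + 1) := mul_le_mul_of_nonneg_left hs'1 (abs_nonneg c)
    have h : a + 1 - c * s' < ‖y‖ := by linarith
    simp [hΦ, cutoff_eq_zero h]
  have key := hasDerivAt_integral_of_support_subset (μ := (volume : Measure (EuclideanSpace ℝ (Fin n))))
    hSo hΦs hK hsupp hsS
  -- Step 2: the height derivative of the integrand, with the balance law inserted
  have hes : ∀ s', ContDiff ℝ ∞ (e s') := contDiff_slice he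
  have hσs : ∀ s', ContDiff ℝ ∞ (σ s') := contDiff_slice hσ
  have hfs : ∀ i s', ContDiff ℝ ∞ (f i s') := fun i => contDiff_slice (hf i)
  have hderiv : ∀ y, deriv (fun s' => Φ s' y) s =
      deriv (fun v : ℝ => Real.smoothTransition (a + 1 - v)) (√(1 + ‖y‖ ^ 2) + c * s) * c * e s y +
        Real.smoothTransition (a + 1 - (√(1 + ‖y‖ ^ 2) + c * s)) * σ s y -
        Real.smoothTransition (a + 1 - (√(1 + ‖y‖ ^ 2) + c * s)) *
          ∑ i, fderiv ℝ (f i s) y (EuclideanSpace.single i 1) := by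
    intro y
    have het : HasDerivAt (fun s' => e s' y) (deriv (fun s' => e s' y) s) s :=
      ((contDiff_line he y).differentiable (by simp) s).hasDerivAt
    have h := ((hasDerivAt_cutoff a c s y).fun_mul het).deriv
    simp only [hΦ]
    rw [h, eq_sub_of_add_eq (hbal s y)]
    ring
  -- Step 3: integrability of the pieces (compact support in `y`)
  have hc1 : ∀ i, Continuous fun y : EuclideanSpace ℝ (Fin n) => fderiv ℝ (f i s) y (EuclideanSpace.single i 1) :=
    fun i => ((hfs i s).continuous_fderiv (by simp)).clm_apply continuous_const
  have hc2 : ∀ i, Continuous fun y : EuclideanSpace ℝ (Fin n) => y i / √(1 + ‖y‖ ^ 2) * f i s y := fun i =>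
    (((PiLp.proj (𝕜 := ℝ) 2 (fun _ : Fin n => ℝ) i).continuous.div
      (contDiff_bracket (k := 0)).continuous
      fun y => (bracket_pos y).ne')).mul (hfs i s).continuous
  have hce : Continuous fun y : EuclideanSpace ℝ (Fin n) => c * e s y := continuous_const.mul (hes s).continuous
  have hI1' : Integrable fun y : EuclideanSpace ℝ (Fin n) =>
      deriv (fun v : ℝ => Real.smoothTransition (a + 1 - v)) (√(1 + ‖y‖ ^ 2) + c * s) * c * e s y := by
    refine (integrable_deriv_cutoff_mul a c s hce).congr (Eventually.of_forall fun y => ?_)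
    simp only [mul_assoc]
  have hIσ : Integrable fun y : EuclideanSpace ℝ (Fin n) =>
      Real.smoothTransition (a + 1 - (√(1 + ‖y‖ ^ 2) + c * s)) * σ s y :=
    integrable_cutoff_mul a c s (hσs s).continuous
  have hI12 : Integrable fun y : EuclideanSpace ℝ (Fin n) =>
      deriv (fun v : ℝ => Real.smoothTransition (a + 1 - v)) (√(1 + ‖y‖ ^ 2) + c * s) * c * e s y +
        Real.smoothTransition (a + 1 - (√(1 + ‖y‖ ^ 2) + c * s)) * σ s y := hI1'.add hIσ
  have hI2 : ∀ i, Integrable fun y : EuclideanSpace ℝ (Fin n) =>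
      Real.smoothTransition (a + 1 - (√(1 + ‖y‖ ^ 2) + c * s)) *
        fderiv ℝ (f i s) y (EuclideanSpace.single i 1) := fun i =>
    integrable_cutoff_mul a c s (hc1 i)
  have hI3 : ∀ i, Integrable fun y : EuclideanSpace ℝ (Fin n) =>
      deriv (fun v : ℝ => Real.smoothTransition (a + 1 - v)) (√(1 + ‖y‖ ^ 2) + c * s) *
        (y i / √(1 + ‖y‖ ^ 2) * f i s y) := fun i =>
    integrable_deriv_cutoff_mul a c s (hc2 i)
  -- Step 4: integration by parts in each spatial direction
  have hibp : ∀ i, ∫ y : EuclideanSpace ℝ (Fin n), Real.smoothTransition (a + 1 - (√(1 + ‖y‖ ^ 2) + c * s)) *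
      fderiv ℝ (f i s) y (EuclideanSpace.single i 1) =
      -∫ y : EuclideanSpace ℝ (Fin n), deriv (fun v : ℝ => Real.smoothTransition (a + 1 - v)) (√(1 + ‖y‖ ^ 2) + c * s) *
        (y i / √(1 + ‖y‖ ^ 2) * f i s y) := by
    intro i
    rw [integral_mul_fderiv_eq_neg_of_hasCompactSupport (contDiff_cutoff a c s) (hasCompactSupport_cutoff a c s)
      ((hfs i s).of_le (by exact_mod_cast le_top)) (EuclideanSpace.single i 1)]
    congr 1
    refine integral_congr_ae (Eventually.of_forall fun y => ?_)
    simp only [fderiv_cutoff_single]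
    ring
  -- Step 5: assemble
  refine key.congr_deriv ?_
  calc ∫ y : EuclideanSpace ℝ (Fin n), deriv (fun s' => Φ s' y) s
      = ∫ y : EuclideanSpace ℝ (Fin n),
          ((deriv (fun v : ℝ => Real.smoothTransition (a + 1 - v)) (√(1 + ‖y‖ ^ 2) + c * s) * c * e s y +
            Real.smoothTransition (a + 1 - (√(1 + ‖y‖ ^ 2) + c * s)) * σ s y) -
          ∑ i, Real.smoothTransition (a + 1 - (√(1 + ‖y‖ ^ 2) + c * s)) *
            fderiv ℝ (f i s) y (EuclideanSpace.single i 1)) := by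
        refine integral_congr_ae (Eventually.of_forall fun y => ?_)
        simp only [hderiv, Finset.mul_sum]
    _ = ((∫ y : EuclideanSpace ℝ (Fin n),
            deriv (fun v : ℝ => Real.smoothTransition (a + 1 - v)) (√(1 + ‖y‖ ^ 2) + c * s) * c * e s y) +
          ∫ y : EuclideanSpace ℝ (Fin n), Real.smoothTransition (a + 1 - (√(1 + ‖y‖ ^ 2) + c * s)) * σ s y) -
          ∑ i, ∫ y : EuclideanSpace ℝ (Fin n), Real.smoothTransition (a + 1 - (√(1 + ‖y‖ ^ 2) + c * s)) *
            fderiv ℝ (f i s) y (EuclideanSpace.single i 1) := by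
        rw [integral_sub hI12 (integrable_finsetSum _ fun i _ => hI2 i),
          integral_add hI1' hIσ, integral_finsetSum _ fun i _ => hI2 i]
    _ = ((∫ y : EuclideanSpace ℝ (Fin n),
            deriv (fun v : ℝ => Real.smoothTransition (a + 1 - v)) (√(1 + ‖y‖ ^ 2) + c * s) * c * e s y) +
          ∑ i, ∫ y : EuclideanSpace ℝ (Fin n), deriv (fun v : ℝ => Real.smoothTransition (a + 1 - v)) (√(1 + ‖y‖ ^ 2) + c * s) *
            (y i / √(1 + ‖y‖ ^ 2) * f i s y)) +
          ∫ y : EuclideanSpace ℝ (Fin n), Real.smoothTransition (a + 1 - (√(1 + ‖y‖ ^ 2) + c * s)) * σ s y := by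
        simp only [hibp, Finset.sum_neg_distrib, sub_neg_eq_add]
        ring
    _ = (∫ y : EuclideanSpace ℝ (Fin n),
            (deriv (fun v : ℝ => Real.smoothTransition (a + 1 - v)) (√(1 + ‖y‖ ^ 2) + c * s) * c * e s y +
              ∑ i, deriv (fun v : ℝ => Real.smoothTransition (a + 1 - v)) (√(1 + ‖y‖ ^ 2) + c * s) *
                (y i / √(1 + ‖y‖ ^ 2) * f i s y))) +
          ∫ y : EuclideanSpace ℝ (Fin n), Real.smoothTransition (a + 1 - (√(1 + ‖y‖ ^ 2) + c * s)) * σ s y := by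
        rw [integral_add hI1' (integrable_finsetSum _ fun i _ => hI3 i),
          integral_finsetSum _ fun i _ => hI3 i]
    _ = _ := by
        congr 1
        refine integral_congr_ae (Eventually.of_forall fun y => ?_)
        have hb := (bracket_pos y).ne'
        simp only [Finset.mul_sum, mul_add]
        congr 1
        · field_simp
        · exact Finset.sum_congr rfl fun i _ => by field_simp

/-- **The local energy inequality (differential form).**  If moreover the flux is DOMINATED by the energy at speed `c`,
`0 ≤ c⟨y⟩ e(s, y) + Σᵢ yᵢ fᵢ(s, y)` (e.g. `|f| ≤ c e`), then `M'(s) ≤ ∫ χ_a(⟨y⟩ + cs) σ(s, y) dy` (`χ_a' ≤ 0`). [folklore] -/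
theorem deriv_coneEnergy_le (he : ContDiff ℝ ∞ (uncurry e)) (hf : ∀ i, ContDiff ℝ ∞ (uncurry (f i)))
    (hσ : ContDiff ℝ ∞ (uncurry σ))
    (hbal : ∀ s y, deriv (fun s' => e s' y) s +
      ∑ i, fderiv ℝ (f i s) y (EuclideanSpace.single i 1) = σ s y)
    (a c : ℝ) {s : ℝ}
    (hflux : ∀ y : EuclideanSpace ℝ (Fin n), 0 ≤ c * √(1 + ‖y‖ ^ 2) * e s y + ∑ i, y i * f i s y) :
    deriv (fun s' => ∫ y : EuclideanSpace ℝ (Fin n),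
        Real.smoothTransition (a + 1 - (√(1 + ‖y‖ ^ 2) + c * s')) * e s' y) s ≤
      ∫ y : EuclideanSpace ℝ (Fin n), Real.smoothTransition (a + 1 - (√(1 + ‖y‖ ^ 2) + c * s)) * σ s y := by
  rw [(hasDerivAt_coneEnergy he hf hσ hbal a c s).deriv]
  have h0 : ∫ y : EuclideanSpace ℝ (Fin n),
      deriv (fun v : ℝ => Real.smoothTransition (a + 1 - v)) (√(1 + ‖y‖ ^ 2) + c * s) / √(1 + ‖y‖ ^ 2) *
        (c * √(1 + ‖y‖ ^ 2) * e s y + ∑ i, y i * f i s y) ≤ 0 := by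
    refine integral_nonpos fun y => ?_
    have h1 := deriv_profile_nonpos (a + 1) (√(1 + ‖y‖ ^ 2) + c * s)
    have h2 := bracket_pos y
    exact mul_nonpos_iff.2 (Or.inr ⟨div_nonpos_iff.2 (Or.inr ⟨h1, h2.le⟩), hflux y⟩)
  linarith

/-- **The local energy inequality (Grönwall form).**  Balance law, flux dominance for `s ≥ t₀`, and a source controlled by the energy,
`σ(s, y) ≤ K e(s, y)` for `s ≥ t₀`: then the cone energy grows at most exponentially,
`M(t) ≤ exp(K (t − t₀)) · M(t₀)` for `t ≥ t₀`. [folklore] -/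
theorem coneEnergy_le_exp_mul (he : ContDiff ℝ ∞ (uncurry e)) (hf : ∀ i, ContDiff ℝ ∞ (uncurry (f i)))
    (hσ : ContDiff ℝ ∞ (uncurry σ))
    (hbal : ∀ s y, deriv (fun s' => e s' y) s +
      ∑ i, fderiv ℝ (f i s) y (EuclideanSpace.single i 1) = σ s y)
    (a c : ℝ) {t₀ K : ℝ}
    (hflux : ∀ s, t₀ ≤ s → ∀ y : EuclideanSpace ℝ (Fin n), 0 ≤ c * √(1 + ‖y‖ ^ 2) * e s y + ∑ i, y i * f i s y)
    (hsrc : ∀ s, t₀ ≤ s → ∀ y : EuclideanSpace ℝ (Fin n), σ s y ≤ K * e s y)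
    {t : ℝ} (ht : t₀ ≤ t) :
    ∫ y : EuclideanSpace ℝ (Fin n), Real.smoothTransition (a + 1 - (√(1 + ‖y‖ ^ 2) + c * t)) * e t y ≤
      Real.exp (K * (t - t₀)) *
        ∫ y : EuclideanSpace ℝ (Fin n), Real.smoothTransition (a + 1 - (√(1 + ‖y‖ ^ 2) + c * t₀)) * e t₀ y := by
  set M : ℝ → ℝ := fun s' => ∫ y : EuclideanSpace ℝ (Fin n),
    Real.smoothTransition (a + 1 - (√(1 + ‖y‖ ^ 2) + c * s')) * e s' y with hM
  have hd : ∀ s', HasDerivAt M (deriv M s') s' := fun s' =>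
    (hasDerivAt_coneEnergy he hf hσ hbal a c s').differentiableAt.hasDerivAt
  have hes : ∀ s', ContDiff ℝ ∞ (e s') := contDiff_slice he
  have hσs : ∀ s', ContDiff ℝ ∞ (σ s') := contDiff_slice hσ
  -- `M' ≤ K M` on `[t₀, ∞)`
  have hM' : ∀ s', t₀ ≤ s' → deriv M s' ≤ K * M s' := by
    intro s' hs'
    have h1 := deriv_coneEnergy_le he hf hσ hbal a c (hflux s' hs')
    have h2 : ∫ y : EuclideanSpace ℝ (Fin n), Real.smoothTransition (a + 1 - (√(1 + ‖y‖ ^ 2) + c * s')) * σ s' y ≤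
        ∫ y : EuclideanSpace ℝ (Fin n), K * (Real.smoothTransition (a + 1 - (√(1 + ‖y‖ ^ 2) + c * s')) * e s' y) := by
      refine integral_mono (integrable_cutoff_mul a c s' (hσs s').continuous)
        ((integrable_cutoff_mul a c s' (hes s').continuous).const_mul K) fun y => ?_
      have := mul_le_mul_of_nonneg_left (hsrc s' hs' y) (Real.smoothTransition.nonneg (a + 1 - (√(1 + ‖y‖ ^ 2) + c * s')))
      simpa only [mul_left_comm] using this
    rw [integral_const_mul] at h2
    exact h1.trans h2
  -- `g(s) = exp(-K s) M(s)` is non-increasing on `[t₀, ∞)`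
  set g : ℝ → ℝ := fun s' => Real.exp (-K * s') * M s' with hg
  have hgd : ∀ s', HasDerivAt g (Real.exp (-K * s') * (-K) * M s' + Real.exp (-K * s') * deriv M s') s' := by
    intro s'
    have h1 : HasDerivAt (fun s' => Real.exp (-K * s')) (Real.exp (-K * s') * (-K)) s' := by
      simpa using ((hasDerivAt_id s').const_mul (-K)).exp
    exact h1.mul (hd s')
  have hanti : AntitoneOn g (Ici t₀) := by
    refine antitoneOn_of_deriv_nonpos (convex_Ici t₀) (fun s' _ => (hgd s').continuousAt.continuousWithinAt)
      (fun s' _ => (hgd s').differentiableAt.differentiableWithinAt) fun s' hs' => ?_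
    rw [interior_Ici] at hs'
    rw [(hgd s').deriv]
    have hE : 0 < Real.exp (-K * s') := Real.exp_pos _
    have := hM' s' (le_of_lt hs')
    nlinarith
  have hgt := hanti (self_mem_Ici (a := t₀)) (mem_Ici.2 ht) ht
  -- unfold and rearrange
  simp only [hg] at hgt
  have hE0 : 0 < Real.exp (-K * t) := Real.exp_pos _
  have hexp : Real.exp (K * (t - t₀)) * Real.exp (-K * t) = Real.exp (-K * t₀) := by
    rw [← Real.exp_add]
    congr 1
    ring
  have : M t * Real.exp (-K * t) ≤ (Real.exp (K * (t - t₀)) * M t₀) * Real.exp (-K * t) := by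
    rw [mul_assoc, mul_comm (M t₀), ← mul_assoc, hexp]
    linarith
  exact le_of_mul_le_mul_right this hE0

/-- **Domain of dependence at speed `c` (ball form).**  Balance law; for heights `s ≥ t₀`: nonnegative energy, dominated flux and a source
`σ ≤ K e`.  Then for every `t ≥ t₀` and every radius `ρ` the energy in the ball `|y| ≤ ρ` at height `t` is controlled by the energy at
height `t₀` in the ball of radius `√(1 + ρ²) + c (t − t₀) + 1` (the backward cone of speed `c`, widened by the unit transition shell of the
smooth cutoff): `∫_{|y| ≤ ρ} e(t, y) dy ≤ exp(K(t − t₀)) ∫_{|y| ≤ √(1+ρ²) + c(t−t₀) + 1} e(t₀, y) dy`. [folklore] -/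
theorem setIntegral_closedBall_le_exp_mul (he : ContDiff ℝ ∞ (uncurry e)) (hf : ∀ i, ContDiff ℝ ∞ (uncurry (f i)))
    (hσ : ContDiff ℝ ∞ (uncurry σ))
    (hbal : ∀ s y, deriv (fun s' => e s' y) s +
      ∑ i, fderiv ℝ (f i s) y (EuclideanSpace.single i 1) = σ s y)
    {c t₀ K : ℝ}
    (hpos : ∀ s, t₀ ≤ s → ∀ y : EuclideanSpace ℝ (Fin n), 0 ≤ e s y)
    (hflux : ∀ s, t₀ ≤ s → ∀ y : EuclideanSpace ℝ (Fin n), 0 ≤ c * √(1 + ‖y‖ ^ 2) * e s y + ∑ i, y i * f i s y)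
    (hsrc : ∀ s, t₀ ≤ s → ∀ y : EuclideanSpace ℝ (Fin n), σ s y ≤ K * e s y)
    {t : ℝ} (ht : t₀ ≤ t) (ρ : ℝ) :
    ∫ y in closedBall (0 : EuclideanSpace ℝ (Fin n)) ρ, e t y ≤
      Real.exp (K * (t - t₀)) *
        ∫ y in closedBall (0 : EuclideanSpace ℝ (Fin n)) (√(1 + ρ ^ 2) + c * (t - t₀) + 1), e t₀ y := by
  set a : ℝ := √(1 + ρ ^ 2) + c * t with ha
  have hes : ∀ s', ContDiff ℝ ∞ (e s') := contDiff_slice he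
  have hgr := coneEnergy_le_exp_mul he hf hσ hbal a c hflux hsrc ht
  -- at height `t` the cutoff is `1` on the ball of radius `ρ`
  have h3 : ∫ y in closedBall (0 : EuclideanSpace ℝ (Fin n)) ρ, e t y ≤
      ∫ y : EuclideanSpace ℝ (Fin n), Real.smoothTransition (a + 1 - (√(1 + ‖y‖ ^ 2) + c * t)) * e t y := by
    calc ∫ y in closedBall (0 : EuclideanSpace ℝ (Fin n)) ρ, e t y
        = ∫ y in closedBall (0 : EuclideanSpace ℝ (Fin n)) ρ,
            Real.smoothTransition (a + 1 - (√(1 + ‖y‖ ^ 2) + c * t)) * e t y := by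
          refine setIntegral_congr_fun measurableSet_closedBall fun y hy => ?_
          rw [mem_closedBall, dist_zero_right] at hy
          have hy2 : ‖y‖ ^ 2 ≤ ρ ^ 2 := by nlinarith [norm_nonneg y]
          have hle : √(1 + ‖y‖ ^ 2) + c * t ≤ a := by
            rw [ha]
            gcongr
          simp only [cutoff_eq_one hle, one_mul]
      _ ≤ ∫ y : EuclideanSpace ℝ (Fin n), Real.smoothTransition (a + 1 - (√(1 + ‖y‖ ^ 2) + c * t)) * e t y :=
          setIntegral_le_integral (integrable_cutoff_mul a c t (hes t).continuous)
            (Eventually.of_forall fun y => mul_nonneg (Real.smoothTransition.nonneg _) (hpos t ht y))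
  -- at height `t₀` the cutoff is `≤ 1` and vanishes outside the ball of radius `a + 1 - c t₀`
  have hR : a + 1 - c * t₀ = √(1 + ρ ^ 2) + c * (t - t₀) + 1 := by rw [ha]; ring
  have h4 : ∫ y : EuclideanSpace ℝ (Fin n), Real.smoothTransition (a + 1 - (√(1 + ‖y‖ ^ 2) + c * t₀)) * e t₀ y ≤
      ∫ y in closedBall (0 : EuclideanSpace ℝ (Fin n)) (√(1 + ρ ^ 2) + c * (t - t₀) + 1), e t₀ y := by
    have hzero : ∀ y ∉ closedBall (0 : EuclideanSpace ℝ (Fin n)) (√(1 + ρ ^ 2) + c * (t - t₀) + 1),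
        Real.smoothTransition (a + 1 - (√(1 + ‖y‖ ^ 2) + c * t₀)) * e t₀ y = 0 := by
      intro y hy
      rw [mem_closedBall, dist_zero_right, not_le, ← hR] at hy
      simp [cutoff_eq_zero hy]
    rw [← setIntegral_eq_integral_of_forall_compl_eq_zero hzero]
    refine setIntegral_mono_on (integrable_cutoff_mul a c t₀ (hes t₀).continuous).integrableOn
      ((hes t₀).continuous.continuousOn.integrableOn_compact (isCompact_closedBall _ _))
      measurableSet_closedBall fun y _ => ?_
    exact mul_le_of_le_one_left (hpos t₀ le_rfl y) (Real.smoothTransition.le_one _)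
  have hE : 0 ≤ Real.exp (K * (t - t₀)) := (Real.exp_pos _).le
  calc ∫ y in closedBall (0 : EuclideanSpace ℝ (Fin n)) ρ, e t y
      ≤ ∫ y : EuclideanSpace ℝ (Fin n), Real.smoothTransition (a + 1 - (√(1 + ‖y‖ ^ 2) + c * t)) * e t y := h3
    _ ≤ Real.exp (K * (t - t₀)) *
        ∫ y : EuclideanSpace ℝ (Fin n), Real.smoothTransition (a + 1 - (√(1 + ‖y‖ ^ 2) + c * t₀)) * e t₀ y := hgr
    _ ≤ Real.exp (K * (t - t₀)) *
        ∫ y in closedBall (0 : EuclideanSpace ℝ (Fin n)) (√(1 + ρ ^ 2) + c * (t - t₀) + 1), e t₀ y :=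
        mul_le_mul_of_nonneg_left h4 hE

end ConeEnergy

end Summit.NavierStokesRegularity.NavierStokesRegularity.Theorems.PoloidalWindowDoorPoloidalWindowRigidityZShockLocalEnergy

end
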